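import Literature.AlgebraicGeometry.HodgeTheory.MotivatedClassesAssembly
import Literature.AlgebraicGeometry.HodgeTheory.MotivatedClassesAlgebraic
import Literature.AlgebraicGeometry.HodgeTheory.AlgebraicClassesPullbackOfCupProduct
import Literature.AlgebraicGeometry.HodgeTheory.MovingLemmaExcessInduction
import Literature.AlgebraicGeometry.HodgeTheory.HardLefschetzNFoldHolds
import Literature.AlgebraicGeometry.HodgeTheory.ComplexConjugationHolds
import Literature.AlgebraicGeometry.HodgeTheory.HodgeConjecture
import HarnessLib

/-!
# André's reduction of the Hodge conjecture: `B` for all varieties ∧ "Hodge classes are motivated" ⟹ the Hodge conjecture, modulo the multiplicativity of algebraic classes (Literature twin of the summit bridge)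

Family `hodge`, layer `Literature/AlgebraicGeometry/HodgeTheory`. Y. André, *Pour une théorie
inconditionnelle des motifs*, Publ. Math. IHÉS 83 (1996), read on the materialised pages (PDF p. 4 =
journal p. 7, §0.3): "Nous appellerons cycles motivés […] les éléments de `A_mot(X)` (cette notion se
réduit à celle de cycle algébrique si pour tout objet de `𝒱` l'involution `*_L` est donnée par une
correspondance algébrique)"; (PDF p. 11 = journal p. 14, §2.1, after Déf. 1): "Il est clair que
`A_mot(X)_E` contient `A(X)` et `*A(X)` […], et que `A_mot(X) = A(X)` si pour tout schéma `Y` dans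
`𝒱`, polarisé, l'involution de Lefschetz est donnée par une correspondance algébrique." Consequently
(the strong-hypothesis bridge `MotivatedSummit ⟹ HodgeConjecture` of the summit's registry
`Summits/HodgeConjecture/StrongHypotheses.lean`, D-0034): IF Grothendieck's standard conjecture of
Lefschetz type `B(Z)` holds for every smooth projective complex `Z` (André's `*_L`-form,
`StandardConjectureBStar`) AND every rational `(p,p)`-class on every smooth projective complex
variety is motivated (`motivatedClasses`, Déf. 1 on the real carriers), THEN every rational
`(p,p)`-class is algebraic, i.e. `HodgeConjectureFor n X` for every smooth projective `X`.

This file is the LITERATURE TWIN of that bridge (no `Summits` import): its conclusion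
`∀ n X, IsSmoothProjective n X → HodgeConjectureFor n X` is definitionally the summit statement, and
its two hypotheses are definitionally the two conjuncts of `MotivatedSummit`, so the summit-side fold
is a one-liner. On the tree's real carriers the one step of André's "il est clair" that is NOT a
theorem is the multiplicativity `Nᵃ H²ᵃ ∪ Nᵇ H²ᵇ ⊆ Nᵃ⁺ᵇ` (C. Voisin, *Hodge Theory and Complex Algebraic
Geometry II*, Prop. 9.20 with Lemmas 9.18, 9.22 = Chow's moving lemma; W. Fulton, *Intersection
Theory*, §19.1–19.2, §11.4): the tree's named fact `Voisin2003_cupProduct_algebraicClasses`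
(`MotivatedClassesAssembly`, REUSED here), reduced by theorems to the cone step of the moving lemma
(`MovingLemmaExcessInduction`). Everything below is a composition of tree theorems; the file
introduces no definition and no named fact (D-0026).

* `hodgeConjectureFor_of_standardConjectureB_of_motivated_of_cupProduct` — André's implication
  modulo Prop. 9.20 on the coniveau carrier;
* `…_of_fulton1998`, `…_of_map_diagonal`, `…_of_coneStep` — the same modulo the tree's three
  equivalent renderings of that input (Fulton Cor. 19.2 (b); Voisin Prop. 9.21 (i) for diagonals;
  the cone step of Lemma 9.22 on every variety);
* `motivated_of_hodgeConjectureFor` — conversely and UNCONDITIONALLY, the Hodge conjecture for `X`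
  makes every rational `(p,p)`-class of `X` motivated (`A(X) ⊆ A_mot(X)`, "il est clair", the tree's
  `algebraicClasses_le_motivatedClasses_of_nonempty_hardLefschetzNFold` with the hard Lefschetz
  THEOREM `nonempty_hardLefschetzNFold_holds`);
* `motivated_iff_hodgeConjectureFor_of_standardConjectureB_of_cupProduct` — hence in the `B`-world
  (and modulo Prop. 9.20) "Hodge classes are motivated" IS the Hodge conjecture (André §0.4 / §0.6:
  the motivated analogue of "Hodge ⟹ absolute Hodge").

## Why the strong hypotheses do not shortcut Prop. 9.20 (recorded for planners)

For a generator `pr_{X*}(α ∪ *_L β)` of `motivatedClasses n X p` (auxiliary `Y` of dimension `m`,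
`α ∈ Nᵃ`, `β ∈ Nᵇ` on `X ⊗ Y`, `*_L β ∈ H^{2b'}`, `a + b' = p + m`, `b + b' = n + m`) the tree's
support calculus (cup product with supports, `AlgebraicClassesCup`; Gysin maps lower the codimension
of supports by the fibre dimension, `MotivatedClassesProofs`) puts the generator in `N¹ H²ᵖ(X)` — where
the tree's divisor induction (`DivisorInduction`, over Deligne's Cor. 8.2.8 and the semisimplicity
lift, both theorems now) would run an induction on `p` — exactly when `a > m` or
`b ≤ b' < n`; the generators with `a ≤ m`, `b' ≥ p` that use the INVERSE Lefschetz isomorphism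
(`b > b'`, the operation motivated cycles adjoin) escape every support count, and for them
`α ∪ *_L β ∈ N^{p+m}(X ⊗ Y)` is Prop. 9.20 itself (two classes supported on one common subvariety:
an excess / self-intersection class, invisible to supports). Under `B`, `*_L β = pr_{1*}(pr_2^* β ∪ γ)`
only moves the same product to `(X ⊗ Y)²`.

## References

* [Andre1996Motifs] Y. André, Publ. Math. IHÉS 83 (1996) 5–49: §0.3 (p. 7), §0.4 (p. 8), §2.1
  Déf. 1 and the remark following it (p. 14).
* [VoisinHodgeII2003] C. Voisin, Hodge Theory and Complex Algebraic Geometry II (CUP 2003), §9.2.4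
  Prop. 9.20, Prop. 9.21 (i), Lemma 9.22.
* [Fulton1998] W. Fulton, Intersection Theory, 2nd ed. (1998), §11.4, §19.1, §19.2 Cor. 19.2 (b).
* [Deligne2000] P. Deligne, The Hodge conjecture (Clay 2000), §1.
-/

noncomputable section

open CategoryTheory AlgebraicGeometry MonoidalCategory CartesianMonoidalCategory
open Literature.AlgebraicTopology.SingularHomology Literature.Geometry.Kaehler

namespace Literature.AlgebraicGeometry.HodgeTheory

section HodgeTheory

/-! ### André's implication, modulo the multiplicativity of algebraic classes -/

/-- **`B` for all ∧ Hodge ⟹ motivated for all ⟹ the Hodge conjecture for all, modulo Voisin II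
Prop. 9.20 on the coniveau carrier** (André 1996, §0.3 p. 7 and §2.1 remark after Déf. 1, p. 14:
under `B`, `A_mot(X) = A(X)`; so a motivated Hodge class is algebraic). GIVEN the multiplicativity of
algebraic classes on every smooth projective complex variety
(`hcup : Voisin2003_cupProduct_algebraicClasses`), IF `*_L` of every polarisation class of every
smooth projective `Z` is an algebraic correspondence (`hB`, `StandardConjectureBStar`) AND every
rational `(p,p)`-class of every smooth projective `X` is motivated (`hM`), THEN `HodgeConjectureFor n X`
for every smooth projective `X`: Hodge models exist (`nonempty_hodgeModel_holds`), and a rational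
`(p,p)`-class is motivated (`hM`), hence algebraic by the tree's assembly
`Andre1996_motivatedClasses_le_algebraicClasses_of_standardConjectureB_holds_of hcup hB`.
[cite: Andre1996Motifs, §0.3 (p. 7) and §2.1 remark following Déf. 1 (p. 14)]
[cite: VoisinHodgeII2003, §9.2.4 Prop. 9.20] -/
theorem hodgeConjectureFor_of_standardConjectureB_of_motivated_of_cupProduct
    (hcup : Voisin2003_cupProduct_algebraicClasses)
    (hB : ∀ (d : ℕ) (Z : Motives.SchemeOver ℂ) (η : complexBetti Z 2), Motives.IsSmoothProjective d Z →
      StandardConjectureBStar d Z η)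
    (hM : ∀ ⦃n : ℕ⦄ ⦃X : Motives.SchemeOver ℂ⦄, Motives.IsSmoothProjective n X →
      ∀ (p : ℕ) (c : complexBetti X (2 * p)), IsRationalClass c → IsOfHodgeType n X (2 * p) p p c →
        c ∈ motivatedClasses n X p)
    ⦃n : ℕ⦄ ⦃X : Motives.SchemeOver ℂ⦄ (hX : Motives.IsSmoothProjective n X) : HodgeConjectureFor n X :=
  ⟨nonempty_hodgeModel_holds hX, fun p c hc hpp ↦
    Andre1996_motivatedClasses_le_algebraicClasses_of_standardConjectureB_holds_of hcup hB hX p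
      (hM hX p c hc hpp)⟩

/-- **The same, modulo Fulton's Cor. 19.2 (b)** (pull-backs along morphisms of smooth projective
varieties preserve algebraic classes, the named fact `fulton1998_map_mem_algebraicClasses`,
equivalent on the coniveau carrier to Prop. 9.20, `fulton1998_map_mem_algebraicClasses_iff_cupProduct`).
[cite: Fulton1998, §19.2 Cor. 19.2 (b)] [cite: Andre1996Motifs, §2.1 remark following Déf. 1 (p. 14)] -/
theorem hodgeConjectureFor_of_standardConjectureB_of_motivated_of_fulton1998
    (hF : fulton1998_map_mem_algebraicClasses)
    (hB : ∀ (d : ℕ) (Z : Motives.SchemeOver ℂ) (η : complexBetti Z 2), Motives.IsSmoothProjective d Z →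
      StandardConjectureBStar d Z η)
    (hM : ∀ ⦃n : ℕ⦄ ⦃X : Motives.SchemeOver ℂ⦄, Motives.IsSmoothProjective n X →
      ∀ (p : ℕ) (c : complexBetti X (2 * p)), IsRationalClass c → IsOfHodgeType n X (2 * p) p p c →
        c ∈ motivatedClasses n X p)
    ⦃n : ℕ⦄ ⦃X : Motives.SchemeOver ℂ⦄ (hX : Motives.IsSmoothProjective n X) : HodgeConjectureFor n X :=
  hodgeConjectureFor_of_standardConjectureB_of_motivated_of_cupProduct
    (cupProduct_algebraicClasses_of_fulton1998 hF) hB hM hX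

/-- **The same, modulo Voisin's Prop. 9.21 (i) for diagonals** (pull-back along the diagonal
`Δ : V ⟶ V ⊗ V` of every smooth projective `V` preserves algebraic classes; hypothesis explicit, no
named fact; exterior products of algebraic classes are algebraic unconditionally, so this is
Prop. 9.20 by `motivatedClasses_le_algebraicClasses_of_standardConjectureB_of_map_diagonal`).
[cite: VoisinHodgeII2003, §9.2.4 proof of Prop. 9.20 and Prop. 9.21 (i)]
[cite: Andre1996Motifs, §2.1 remark following Déf. 1 (p. 14)] -/
theorem hodgeConjectureFor_of_standardConjectureB_of_motivated_of_map_diagonal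
    (hΔ : ∀ ⦃d : ℕ⦄ ⦃V : Motives.SchemeOver ℂ⦄, Motives.IsSmoothProjective d V → ∀ (p : ℕ)
      ⦃c : complexBetti (V ⊗ V) (2 * p)⦄, c ∈ algebraicClasses (V ⊗ V) p →
        complexBetti.map (lift (𝟙 V) (𝟙 V)) (2 * p) c ∈ algebraicClasses V p)
    (hB : ∀ (d : ℕ) (Z : Motives.SchemeOver ℂ) (η : complexBetti Z 2), Motives.IsSmoothProjective d Z →
      StandardConjectureBStar d Z η)
    (hM : ∀ ⦃n : ℕ⦄ ⦃X : Motives.SchemeOver ℂ⦄, Motives.IsSmoothProjective n X →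
      ∀ (p : ℕ) (c : complexBetti X (2 * p)), IsRationalClass c → IsOfHodgeType n X (2 * p) p p c →
        c ∈ motivatedClasses n X p)
    ⦃n : ℕ⦄ ⦃X : Motives.SchemeOver ℂ⦄ (hX : Motives.IsSmoothProjective n X) : HodgeConjectureFor n X :=
  ⟨nonempty_hodgeModel_holds hX, fun p c hc hpp ↦
    motivatedClasses_le_algebraicClasses_of_standardConjectureB_of_map_diagonal hΔ hB hX p
      (hM hX p c hc hpp)⟩

/-- **The same, modulo the cone step of Chow's moving lemma on every smooth projective variety**
(Voisin II Lemma 9.22, proof; Fulton §11.4 Thm. 11.4; Roberts 1972, Main Lemma — read on supports as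
the hypothesis `hstep` of the tree's `cupProduct_mem_algebraicClasses_of_coneStep`, quantified over all
smooth projective `V`): for `Z` irreducible closed of codimension `≥ l` meeting the irreducible closed
`W` (codimension `≥ k`) in codimension `≥ s < l + k`, every class of `H²ˡ(V(ℂ); ℂ)` dying off `Z` is the
sum of a class dying off a closed `T` with `codim (T ∩ W) ≥ l + k` and a class dying off a closed `Z'`
of codimension `≥ l` with `codim (Z' ∩ W) ≥ s + 1`. Given it, the tree's excess induction and its
reduction of Prop. 9.20 to moving supports yield `Voisin2003_cupProduct_algebraicClasses`. This is the
exact residue of classical intersection theory between the printed implication and an unconditional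
theorem of the tree. [cite: VoisinHodgeII2003, §9.2.4 Lemma 9.22 (proof) and Prop. 9.20]
[cite: Fulton1998, §11.4 Thm. 11.4] [cite: Andre1996Motifs, §2.1 remark following Déf. 1 (p. 14)] -/
theorem hodgeConjectureFor_of_standardConjectureB_of_motivated_of_coneStep
    (hstep : ∀ ⦃d : ℕ⦄ ⦃V : Motives.SchemeOver ℂ⦄, Motives.IsSmoothProjective d V → ∀ (l k : ℕ)
      ⦃Z W : Set V.left⦄, IsClosed Z → IsIrreducible Z →
      (∀ z ∈ Z, (l : ℕ∞) ≤ Order.coheight z) → IsClosed W → IsIrreducible W →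
      (∀ w ∈ W, (k : ℕ∞) ≤ Order.coheight w) → ∀ s : ℕ, s < l + k →
      (∀ t ∈ Z ∩ W, (s : ℕ∞) ≤ Order.coheight t) →
        LinearMap.ker (complexBetti.restrictCompl V Z (2 * l)).hom ≤
          (⨆ (T : Set V.left) (_ : IsClosed T)
            (_ : ∀ t ∈ T ∩ W, ((l + k : ℕ) : ℕ∞) ≤ Order.coheight t),
            LinearMap.ker (complexBetti.restrictCompl V T (2 * l)).hom) ⊔
          ⨆ (Z' : Set V.left) (_ : IsClosed Z') (_ : ∀ z ∈ Z', (l : ℕ∞) ≤ Order.coheight z)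
            (_ : ∀ t ∈ Z' ∩ W, ((s + 1 : ℕ) : ℕ∞) ≤ Order.coheight t),
            LinearMap.ker (complexBetti.restrictCompl V Z' (2 * l)).hom)
    (hB : ∀ (d : ℕ) (Z : Motives.SchemeOver ℂ) (η : complexBetti Z 2), Motives.IsSmoothProjective d Z →
      StandardConjectureBStar d Z η)
    (hM : ∀ ⦃n : ℕ⦄ ⦃X : Motives.SchemeOver ℂ⦄, Motives.IsSmoothProjective n X →
      ∀ (p : ℕ) (c : complexBetti X (2 * p)), IsRationalClass c → IsOfHodgeType n X (2 * p) p p c →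
        c ∈ motivatedClasses n X p)
    ⦃n : ℕ⦄ ⦃X : Motives.SchemeOver ℂ⦄ (hX : Motives.IsSmoothProjective n X) : HodgeConjectureFor n X :=
  hodgeConjectureFor_of_standardConjectureB_of_motivated_of_cupProduct
    (fun _ _ hV l k _ _ ha hb ↦ cupProduct_mem_algebraicClasses_of_coneStep hV (hstep hV l k) ha hb)
    hB hM hX

/-! ### The converse (unconditional) and the `B`-world equivalence -/

/-- **The Hodge conjecture makes Hodge classes motivated — unconditionally** ("il est clair que
`A_mot(X)_E` contient `A(X)`", André 1996 §2.1 p. 14, on the real carriers: the tree's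
`algebraicClasses_le_motivatedClasses_of_nonempty_hardLefschetzNFold`, the hard Lefschetz datum of
`X ⊗ X` being the THEOREM `nonempty_hardLefschetzNFold_holds`): if `HodgeConjectureFor n X`, every
rational `(p,p)`-class of `X` is motivated. [cite: Andre1996Motifs, §2.1 remark following Déf. 1 (p. 14)] -/
theorem motivated_of_hodgeConjectureFor ⦃n : ℕ⦄ ⦃X : Motives.SchemeOver ℂ⦄
    (hX : Motives.IsSmoothProjective n X) (h : HodgeConjectureFor n X) (p : ℕ)
    (c : complexBetti X (2 * p)) (hc : IsRationalClass c) (hpp : IsOfHodgeType n X (2 * p) p p c) :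
    c ∈ motivatedClasses n X p :=
  algebraicClasses_le_motivatedClasses_of_nonempty_hardLefschetzNFold hX
    (nonempty_hardLefschetzNFold_holds _ _) p (h.2 p c hc hpp)

/-- **In the `B`-world, "Hodge classes are motivated" IS the Hodge conjecture** (André 1996 §0.3–0.4:
motivated cycles reduce to algebraic cycles under `B`; conversely algebraic classes are motivated),
modulo Prop. 9.20 on the coniveau carrier: given `hcup` and `B` for all smooth projective `Z`,
(every rational `(p,p)`-class on every smooth projective `X` is motivated) ↔ (the Hodge conjecture
holds for every smooth projective `X`). [cite: Andre1996Motifs, §0.3 (p. 7) and §2.1 remark following Déf. 1 (p. 14)]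
[cite: VoisinHodgeII2003, §9.2.4 Prop. 9.20] -/
theorem motivated_iff_hodgeConjectureFor_of_standardConjectureB_of_cupProduct
    (hcup : Voisin2003_cupProduct_algebraicClasses)
    (hB : ∀ (d : ℕ) (Z : Motives.SchemeOver ℂ) (η : complexBetti Z 2), Motives.IsSmoothProjective d Z →
      StandardConjectureBStar d Z η) :
    (∀ ⦃n : ℕ⦄ ⦃X : Motives.SchemeOver ℂ⦄, Motives.IsSmoothProjective n X →
      ∀ (p : ℕ) (c : complexBetti X (2 * p)), IsRationalClass c → IsOfHodgeType n X (2 * p) p p c →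
        c ∈ motivatedClasses n X p) ↔
    ∀ ⦃n : ℕ⦄ ⦃X : Motives.SchemeOver ℂ⦄, Motives.IsSmoothProjective n X → HodgeConjectureFor n X :=
  ⟨fun hM _ _ hX ↦ hodgeConjectureFor_of_standardConjectureB_of_motivated_of_cupProduct hcup hB hM hX,
    fun h _ _ hX p c hc hpp ↦ motivated_of_hodgeConjectureFor hX (h hX) p c hc hpp⟩

/-! ### On-path: the Hodge conjecture implies André's Thm. 0.6.2 as typed (appended 2026-08-22)

The named fact `Andre1996_hodgeClasses_abelianVariety_motivated` (`MotivatedClasses.lean`; André 1996,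
Thm. 0.6.2: Hodge classes on complex abelian varieties are motivated) is carried as a HYPOTHESIS by the
ring-2 / stage-4 theorems `hc_av_of_andre_of_motivatedImpliesAlgebraicAV`, `hc_av_of_B_of_andre1996`.
The two one-liners below record that this hypothesis is a CASE of the Hodge conjecture — indeed of the
Hodge conjecture for abelian varieties alone — by `motivated_of_hodgeConjectureFor` ("il est clair que
`A_mot(X)` contient `A(X)`", §2.1 p. 14): the Lean statement is not stronger than what it is used to
prove. No definition, no named fact. -/

/-- **ON-PATH: the Hodge conjecture (for all smooth projective complex varieties) implies André's
Thm. 0.6.2 as typed** — a Hodge class on an abelian variety is algebraic by hypothesis, hence motivated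
(André 1996, §2.1, remark following Déf. 1, p. 14: "Il est clair que `A_mot(X)_E` contient `A(X)`"; on
the real carriers `motivated_of_hodgeConjectureFor`). [cite: Andre1996Motifs, §2.1 remark following Déf. 1 (p. 14) and Thm. 0.6.2 (p. 9)] -/
theorem Andre1996_hodgeClasses_abelianVariety_motivated_of_hodgeConjectureFor
    (h : ∀ ⦃n : ℕ⦄ ⦃X : Motives.SchemeOver ℂ⦄, Motives.IsSmoothProjective n X → HodgeConjectureFor n X) :
    Andre1996_hodgeClasses_abelianVariety_motivated :=
  fun _ hA p c hc hpp ↦ motivated_of_hodgeConjectureFor hA (h hA) p c hc hpp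

/-- **ON-PATH, abelian form: the Hodge conjecture for complex abelian varieties alone implies André's
Thm. 0.6.2 as typed** (the hypothesis is, symbol for symbol, the body of the summit-side target
`HC_AV := ∀ A : AbelianVariety ℂ, HodgeConjectureFor A.dim A.X`; same one-line proof).
[cite: Andre1996Motifs, §2.1 remark following Déf. 1 (p. 14) and Thm. 0.6.2 (p. 9)] -/
theorem Andre1996_hodgeClasses_abelianVariety_motivated_of_hodgeConjectureFor_abelianVariety
    (h : ∀ A : Motives.AbelianVariety ℂ, HodgeConjectureFor A.dim A.X) :
    Andre1996_hodgeClasses_abelianVariety_motivated :=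
  fun A hA p c hc hpp ↦ motivated_of_hodgeConjectureFor hA (h A) p c hc hpp

end HodgeTheory

end Literature.AlgebraicGeometry.HodgeTheory

end
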